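import Mathlib.Topology.Semicontinuity.Basic
import Mathlib.Topology.NoetherianSpace
import Mathlib.AlgebraicGeometry.Noetherian
import Literature.AlgebraicGeometry.Hironaka2017.EdgeHilbert
import Summits.ResolutionOfSingularities.ResolutionOfSingularities.Theorems.MarkedTransferCampaignW31UscInvOneExponent
import Summits.ResolutionOfSingularities.ResolutionOfSingularities.Theorems.MarkedTransferCampaignW31EdgeHilbertLsc
import HarnessLib

/-!
# [OURS · L1 W3.1] The ASSEMBLY of slot W3.1 «u.s.c. first» in the kernel — THEOREMS over the typed campaign statements
# (`Theorems/MarkedTransferCampaignW31UscInvOneExponent.lean` p461513/p463247, `…EdgeHilbertLsc.lean` p464862)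

Cell `res-hironaka`, rung L (rescue) of LADDER-RESOLUTION, slot W3.1 (positive rung, verdict-free), seat res-L1-k31
(kill test K3.1 ALIVE 2026-08-26T19:37Z, p461082/p463819/p463820; this file is its follow-through, report
`HOME/L/res-L1-k31/KILL-TEST-K3.1.md` §7). Host (custody, no new route) = the EXISTING crux
`Theses.MarkedTransfer.HypersurfaceOrderReduction` (stmt-ResolutionOfSingularities-16155, `--supports … --as helper`), as the
two statement files it connects.

HONEST FRAMING. NOTHING here is a statement of H. Hironaka's manuscript *Resolution of singularities in positive
characteristics* (2017-03-23, [Hironaka2017], lit key `paper:url-3343fd9e678b`) and nothing here asserts that any statement of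
that manuscript holds. Every theorem below is PURE LOGIC / point-set topology / the tree's kernel-checked combinatorics
(`Literature/AlgebraicGeometry/Hironaka2017/EdgeHilbert.lean`, `Datum.lean`) over OUR typed carriers; no FACT-LIST premise and no
typed candidate of the manuscript is consumed. What it establishes is how the OURS campaign statements of slot W3.1 imply one
another, so that the three inputs typed for seat res-L1-s31-pv-2 close the slot statement and its two p.30 consequences by name.

## What is proved

* `CampaignW31.le_def`, `CampaignW31.exists_min_key_ge` — bookkeeping on the value type `Datum.EdgeInv n` (order through the
  0-padded `key`, well-founded: tree `Datum.EdgeInv.lt_wellFounded`).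
* `CampaignW31.uscOn_iff_superlevelClosedOn` — the two typed forms of «`ξ ↦ f ξ` is upper semicontinuous on `S_cl`» AGREE for every
  `S` and every `EdgeInv n`-valued `f` (Mathlib `upperSemicontinuousOn_iff_preimage_Ici` on the linear order of keys + the least
  `EdgeInv` value above a given key). Corollaries `campaignW31UscInvOneExponent_iff_CJS` (parametric) and
  `campaignW31UscInvOneExponentI_iff_CJSI` (`p`-slices); `CampaignW31.uscOn_congr` (only the values on `S_cl` matter) and
  `campaignW31UscInvOneExponentR_of_uscInvOneExponent` (the slot statement implies its reading-idiom form `…R`, choosing a selection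
  from `EdgeDataExist`).
* `CampaignW31.noetherianSpace_ambient` — the ambient scheme of an ambient datum (row 001: smooth, quasi-compact over a field) has a
  Noetherian underlying space (Mathlib: locally of finite type over a Noetherian base + quasi-compact).
* `CampaignW31.exists_isInvmax_of_uscOn`, `CampaignW31.invmaxStratum_closed_of_uscOn` — on a Noetherian `Z`, an `EdgeInv`-valued
  function u.s.c. on `S_cl ≠ ∅` ATTAINS its lexicographic maximum there (every subset of a Noetherian space is compact; Mathlib
  `UpperSemicontinuousOn.exists_isMaxOn`), and its `Inv_max`-stratum (row 007's `invmaxStratum`) is the trace of a closed set (it is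
  the superlevel set of the maximum). Corollaries `campaignW31InvmaxClosed_of_uscInvOneExponent` (parametric),
  `campaignW31InvmaxClosedI_of_uscInvOneExponentI` (`p`-slices): THE SLOT STATEMENT IMPLIES THE TWO p.30 CONSEQUENCES (DOSSIER
  group-3 §2 R13b) — no finiteness of the value set is needed for these two.
* `CampaignW31.hilb_expo_inv`, `CampaignW31.inv_q_pairwise` — bridge between row 007's `inv D` (Eq. (34) read off edge data) and the
  tree's `EdgeHilbert.hilb` / sortedness hypothesis.
* `CampaignW31.key_inv_le_of_hilb_le`, `CampaignW31.inv_eq_of_hilb_eq` — Hilbert-function domination between the edge exponents of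
  two edge data forces `Inv` not to rise (tree `Datum.EdgeInv.key_le_of_hilb_le`), and equality of Hilbert functions forces equal
  `Inv` (tree `key_injective`).
* `CampaignW31.uscOn_selInv_of_edgeHilb` — THE ASSEMBLY at one ideal exponent: (i) lower semicontinuity of every
  `ξ ↦ dim G(ξ)_a` on `Sing(E)_cl`, (ii) the dictionary `dim G(ξ)_a = N(q(D); a)` for provenance edge data, (iii) finitely many
  Hilbert functions ⟹ `ξ ↦ Inv_ξ(E)` (read off ANY provenance selection) is upper semicontinuous on `Sing(E)_cl`. Proof: by (iii)
  and (i), near `ξ₀` the Hilbert function dominates the one at `ξ₀` in EVERY degree (finitely many lsc conditions exclude the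
  finitely many non-dominating functions); by (ii) this is domination of `N(q; ·)`; the combinatorial core turns it into
  `Inv_ξ ≤lex Inv_{ξ₀}`.
* `campaignW31UscInvOneExponentI_of_edgeHilb` — `CampaignW31EdgeHilbLsc p → CampaignW31EdgeHilbDictionary p →
  CampaignW31EdgeHilbFiniteRange p → CampaignW31UscInvOneExponentI p`; `campaignW31InvWellDefinedI_of_dictionary` —
  `CampaignW31EdgeHilbDictionary p → CampaignW31InvWellDefinedI p`; `campaignW31InvmaxClosedI_of_edgeHilb` — the chain to the p.30
  consequences.

AI-produced kernel bookkeeping (weaker than expert review as to MEANING; the kernel certifies only that these typed statements imply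
one another as stated).

## References (context only; nothing below is a premise)

* H. Hironaka, ms. 2017-03-23, Eq. (34) p.24 l.29–31; §6.2 p.30 l.4–8; p.86 l.7–10. [Hironaka2017]
* V. Cossart, U. Jannsen, S. Saito, LNM 2270 (2020), Lemma 2.34 (pattern: u.s.c. functions on Noetherian spaces).
  [CossartJannsenSaito2020]
-/

set_option linter.dupNamespace false -- mandated namespace of this single-conjunct summit

open _root_.AlgebraicGeometry _root_.TopologicalSpace _root_.Topology _root_.Filter Set

namespace Summit.ResolutionOfSingularities.ResolutionOfSingularities.Theorems

open Literature.AlgebraicGeometry.Resolution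
open Literature.AlgebraicGeometry.Hironaka2017
open Literature.AlgebraicGeometry.Hironaka2017.S02Preliminaries
open Literature.AlgebraicGeometry.Hironaka2017.S04CharAlgebra
open Literature.AlgebraicGeometry.Hironaka2017.Datum
open Literature.AlgebraicGeometry.Hironaka2017.EdgeHilbert

universe u

namespace CampaignW31

/-! ## The value type: order through the padded key, least value above a key -/

/-- `≤` on `Inv` values is, by definition (tree `Datum.EdgeInv`), `≤` of the 0-padded lexicographic keys. [folklore] -/
theorem le_def {n : ℕ} (v w : EdgeInv n) : v ≤ w ↔ v.key ≤ w.key :=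
  Iff.rfl

/-- `≤` on `Inv` values is transitive (inherited from the keys). [folklore] -/
theorem le_trans' {n : ℕ} {u v w : EdgeInv n} (h₁ : u ≤ v) (h₂ : v ≤ w) : u ≤ w :=
  (le_def u w).mpr (le_trans ((le_def u v).mp h₁) ((le_def v w).mp h₂))

/-- If some `Inv` value has key `≥ b`, there is a LEAST such value `v`, and then `b ≤ w.key ↔ v ≤ w` for every value `w`
(well-foundedness of the order on `EdgeInv n`, tree `Datum.EdgeInv.lt_wellFounded`; linearity of the key order). [folklore] -/
theorem exists_min_key_ge {n : ℕ} (b : Lex (Fin (n + 2) → ℕ)) (h : ∃ w : EdgeInv n, b ≤ w.key) :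
    ∃ v : EdgeInv n, b ≤ v.key ∧ ∀ w : EdgeInv n, b ≤ w.key ↔ v ≤ w := by
  obtain ⟨v, hv, hmin⟩ := EdgeInv.lt_wellFounded.has_min {w : EdgeInv n | b ≤ w.key} h
  refine ⟨v, hv, fun w => ⟨fun hw => ?_, fun hw => le_trans hv ((le_def v w).mp hw)⟩⟩
  have hnot : ¬ w.key < v.key := hmin w hw
  exact (le_def v w).mpr (not_lt.mp hnot)

/-! ## The two typed forms of upper semicontinuity agree -/

/-- **[OURS · L1 W3.1] `UscOn S f ↔ SuperlevelClosedOn S f`** for every point set `S ⊆ Z` and every `EdgeInv n`-valued `f`: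
Mathlib's `UpperSemicontinuousOn` of `ξ ↦ (f ξ).key` on `S_cl` (the typed `CampaignW31.UscOn`) is the same as «every superlevel set
`{ξ ∈ S_cl | v ≤ f ξ}` is the trace on `S_cl` of a closed subset of `Z`» (the typed `CampaignW31.SuperlevelClosedOn`, CJS form).
`⇒`: `upperSemicontinuousOn_iff_preimage_Ici` at `b = v.key`. `⇐`: a key `b` either bounds no value (empty superlevel set) or has
a least value `v` above it (`exists_min_key_ge`), and then `{b ≤ key} = {v ≤ ·}`. Replaces nothing printed (pure topology on OUR
value type); NOT a statement of the manuscript. [folklore] -/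
theorem uscOn_iff_superlevelClosedOn {Z : Scheme.{u}} {n : ℕ} (S : Set Z) (f : Z → EdgeInv n) :
    UscOn S f ↔ SuperlevelClosedOn S f := by
  unfold UscOn SuperlevelClosedOn
  rw [upperSemicontinuousOn_iff_preimage_Ici]
  constructor
  · intro h v
    obtain ⟨C, hC, hEq⟩ := h v.key
    refine ⟨C, hC, fun ξ hξ => ?_⟩
    have hx := Set.ext_iff.mp hEq ξ
    simp only [mem_inter_iff, mem_preimage, mem_Ici] at hx
    rw [le_def]
    exact ⟨fun hle => (hx.mp ⟨hξ, hle⟩).2, fun hC' => (hx.mpr ⟨hξ, hC'⟩).2⟩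
  · intro h b
    by_cases hb : ∃ w : EdgeInv n, b ≤ w.key
    · obtain ⟨v, _, hv⟩ := exists_min_key_ge b hb
      obtain ⟨C, hC, hEq⟩ := h v
      refine ⟨C, hC, Set.ext fun ξ => ?_⟩
      simp only [mem_inter_iff, mem_preimage, mem_Ici]
      exact ⟨fun ⟨hξ, hbξ⟩ => ⟨hξ, (hEq ξ hξ).mp ((hv (f ξ)).mp hbξ)⟩,
        fun ⟨hξ, hξC⟩ => ⟨hξ, (hv (f ξ)).mpr ((hEq ξ hξ).mpr hξC)⟩⟩
    · refine ⟨∅, isClosed_empty, Set.ext fun ξ => ?_⟩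
      simp only [mem_inter_iff, mem_preimage, mem_Ici, mem_empty_iff_false, and_false, iff_false, not_and]
      exact fun _ hbξ => hb ⟨f ξ, hbξ⟩

/-- `UscOn S f` depends only on the values of `f` at the closed points of `S` (immediate in the superlevel-set form).
[folklore] -/
theorem uscOn_congr {Z : Scheme.{u}} {n : ℕ} (S : Set Z) {f g : Z → EdgeInv n}
    (hfg : ∀ ξ ∈ S ∩ S02Preliminaries.closedPoints Z, f ξ = g ξ) (h : UscOn S f) : UscOn S g := by
  rw [uscOn_iff_superlevelClosedOn] at h ⊢
  intro v
  obtain ⟨C, hC, hEq⟩ := h v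
  exact ⟨C, hC, fun ξ hξ => by rw [← hfg ξ hξ]; exact hEq ξ hξ⟩

/-! ## Noetherian ambient space; the maximum is attained and the `Inv_max`-stratum is closed -/

/-- The ambient scheme of an ambient datum (row 001: `Z` irreducible, smooth and quasi-compact over a field `K`) has a Noetherian
underlying topological space: smooth ⟹ locally of finite type over the Noetherian `Spec K` ⟹ locally Noetherian; quasi-compact
over the quasi-compact `Spec K` ⟹ quasi-compact; a Noetherian scheme has a Noetherian space (Mathlib). [folklore] -/
theorem noetherianSpace_ambient {p : ℕ} [Fact p.Prime] {K : Type u} [Field K] [CharP K p] (A : AmbientDatum p K) :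
    NoetherianSpace A.Z := by
  haveI := A.smooth
  haveI := A.quasiCompact
  haveI : IsLocallyNoetherian A.Z := LocallyOfFiniteType.isLocallyNoetherian A.hom
  haveI : CompactSpace A.Z := QuasiCompact.compactSpace_of_compactSpace A.hom
  haveI : IsNoetherian A.Z := ⟨⟩
  infer_instance

/-- **[OURS · L1 W3.1] `Inv_max` IS ATTAINED** for an `EdgeInv n`-valued function u.s.c. on `S_cl ≠ ∅` in a Noetherian `Z` (row
007's `IsInvmax`): every subset of a Noetherian space is compact, and an upper semicontinuous function into a linear order attains its
maximum on a non-empty compact set (Mathlib `UpperSemicontinuousOn.exists_isMaxOn`, applied to the keys). Replaces the role of the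
presupposition «denote the lexicographical maximum» (p.30 l.4–5) ONLY in the sense that it derives the typed `InvmaxAttained` from
the typed `UscOn`; NOT a statement of the manuscript. [folklore] -/
theorem exists_isInvmax_of_uscOn {Z : Scheme.{u}} [NoetherianSpace Z] {n : ℕ} (S : Set Z) (f : Z → EdgeInv n)
    (h : UscOn S f) (hne : (S ∩ S02Preliminaries.closedPoints Z).Nonempty) :
    ∃ v : EdgeInv n, IsInvmax (S ∩ S02Preliminaries.closedPoints Z) f v := by
  obtain ⟨ξ, hξ, hmax⟩ :=
    UpperSemicontinuousOn.exists_isMaxOn hne (NoetherianSpace.isCompact _) h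
  rw [isMaxOn_iff] at hmax
  exact ⟨f ξ, ⟨ξ, hξ, rfl⟩, fun η hη => (le_def _ _).mpr (hmax η hη)⟩

/-- **[OURS · L1 W3.1] the `Inv_max`-STRATUM IS CLOSED in `S_cl`** for an `EdgeInv n`-valued function u.s.c. on `S_cl` in a
Noetherian `Z`: row 007's `invmaxStratum (S ∩ Z_cl) f` is the trace on `S_cl` of a closed subset of `Z` — when `S_cl ≠ ∅` it is the
superlevel set of the attained maximum (`exists_isInvmax_of_uscOn` + `uscOn_iff_superlevelClosedOn`), and `∅` otherwise. Derives the
typed `InvmaxStratumClosed` from the typed `UscOn`; NOT a statement of the manuscript. [folklore] -/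
theorem invmaxStratum_closed_of_uscOn {Z : Scheme.{u}} [NoetherianSpace Z] {n : ℕ} (S : Set Z) (f : Z → EdgeInv n)
    (h : UscOn S f) :
    ∃ C : Set Z, IsClosed C ∧
      invmaxStratum (S ∩ S02Preliminaries.closedPoints Z) f = C ∩ (S ∩ S02Preliminaries.closedPoints Z) := by
  by_cases hne : (S ∩ S02Preliminaries.closedPoints Z).Nonempty
  · obtain ⟨v, ⟨ξ, hξ, rfl⟩, hmax⟩ := exists_isInvmax_of_uscOn S f h hne
    obtain ⟨C, hC, hEq⟩ := (uscOn_iff_superlevelClosedOn S f).mp h (f ξ)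
    refine ⟨C, hC, Set.ext fun η => ?_⟩
    simp only [invmaxStratum, mem_setOf_eq, mem_inter_iff]
    constructor
    · rintro ⟨hηT, hηmax⟩
      exact ⟨(hEq η hηT).mp (hηmax ξ hξ), hηT⟩
    · rintro ⟨hηC, hηT⟩
      exact ⟨hηT, fun ζ hζ => le_trans' (hmax ζ hζ) ((hEq η hηT).mpr hηC)⟩
  · refine ⟨∅, isClosed_empty, Set.ext fun η => ?_⟩
    simp only [invmaxStratum, mem_setOf_eq, empty_inter, mem_empty_iff_false, iff_false, not_and]
    exact fun hη _ => hne ⟨η, hη⟩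

/-- **[OURS · L1 W3.1] at one ideal exponent: `UscOn` ⟹ `InvmaxAttained ∧ InvmaxStratumClosed`** for the function read off ANY
edge-data selection (parametric provenance predicate), on the ambient scheme of an ambient datum (Noetherian by
`noetherianSpace_ambient`). NOT a statement of the manuscript. [folklore] -/
theorem invmaxAttained_and_stratumClosed_of_uscOn {p : ℕ} [Fact p.Prime] {K : Type u} [Field K] [CharP K p]
    (A : AmbientDatum p K) {n : ℕ} {E : IdealExponent A.Z}
    {IsEdgeData : ∀ ⦃X : Scheme.{u}⦄ ⦃p n : ℕ⦄ (E : IdealExponent X) (ξ : X), EdgeDatumAt p n E ξ → Prop}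
    (sel : EdgeDataSelection p n E IsEdgeData) (h : UscOn E.sing (selInv sel)) :
    InvmaxAttained sel ∧ InvmaxStratumClosed sel := by
  haveI : NoetherianSpace A.Z := noetherianSpace_ambient A
  exact ⟨fun hne => exists_isInvmax_of_uscOn E.sing (selInv sel) h hne,
    invmaxStratum_closed_of_uscOn E.sing (selInv sel) h⟩

/-! ## Bridge: row 007's `inv D` versus the tree's Hilbert functions -/

variable {Z : Scheme.{u}} {p : ℕ} [Fact p.Prime] {n : ℕ} {E : IdealExponent Z}

/-- The exponent function of `inv D = (n, n − r, q_1, …, q_r)` (row 007, Eq. (34) read off the edge data `D`) is the edge-exponent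
function `q(D)` of row 005 up to the reindexing `Fin (qList D).length ≃ Fin r`; hence the tree's Hilbert function `N(·; a)` agrees
on both (tree `EdgeHilbert.hilb_cast`). [folklore] -/
theorem hilb_expo_inv {ξ : Z} (D : EdgeDatumAt p n E ξ) (a : ℕ) :
    hilb (inv D).expo a = hilb (EdgeDatum.q D) a := by
  have e : (inv D).q.length = EdgeDatum.r D := List.length_ofFn
  have hexpo : (inv D).expo = fun i => EdgeDatum.q D (Fin.cast e i) := by
    funext i
    exact List.get_ofFn (EdgeDatum.q D) i
  rw [hexpo, hilb_cast]

/-- The exponent list of `inv D` is sorted increasingly (`q_j = p^{e_j}` with `e_j` non-decreasing, row 005's field `expo_mono`,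
Def. 4.11 / Eq. (28)) — the sortedness hypothesis of the tree's `Datum.EdgeInv.key_le_of_hilb_le`. [folklore] -/
theorem inv_q_pairwise {ξ : Z} (D : EdgeDatumAt p n E ξ) : (inv D).q.Pairwise (· ≤ ·) := by
  show (List.ofFn (EdgeDatum.q D)).Pairwise (· ≤ ·)
  rw [List.pairwise_ofFn]
  intro i j hij
  exact Nat.pow_le_pow_right (Fact.out : p.Prime).pos (EdgeDatum.expo_mono D hij.le)

/-- **Hilbert-function domination forces `Inv` not to rise** (tree `Datum.EdgeInv.key_le_of_hilb_le`, restated on edge data): if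
`N(q(D₀); a) ≤ N(q(D); a)` in every degree `a`, then `Inv(D) ≤lex Inv(D₀)` for row 007's values. [folklore] -/
theorem key_inv_le_of_hilb_le {ξ₀ ξ : Z} (D₀ : EdgeDatumAt p n E ξ₀) (D : EdgeDatumAt p n E ξ)
    (h : ∀ a, hilb (EdgeDatum.q D₀) a ≤ hilb (EdgeDatum.q D) a) : (inv D).key ≤ (inv D₀).key := by
  refine EdgeInv.key_le_of_hilb_le (inv D₀) (inv D) (inv_q_pairwise D) fun a => ?_
  rw [hilb_expo_inv, hilb_expo_inv]
  exact h a

/-- **Equal Hilbert functions force equal `Inv`** (domination both ways + tree `Datum.EdgeInv.key_injective`). [folklore] -/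
theorem inv_eq_of_hilb_eq {ξ₀ ξ : Z} (D₀ : EdgeDatumAt p n E ξ₀) (D : EdgeDatumAt p n E ξ)
    (h : ∀ a, hilb (EdgeDatum.q D₀) a = hilb (EdgeDatum.q D) a) : inv D = inv D₀ :=
  EdgeInv.key_injective (le_antisymm (key_inv_le_of_hilb_le D₀ D fun a => (h a).le)
    (key_inv_le_of_hilb_le D D₀ fun a => (h a).ge))

/-! ## The assembly at one ideal exponent -/

/-- **[OURS · L1 W3.1] THE ASSEMBLY at one ideal exponent `E` on a scheme `Z`.** Write `S_cl = Sing(E) ∩ Z_cl` and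
`H(ξ)(a) = dim_{κ(ξ)} G(ξ)_a` (`CampaignW31.edgeHilbAt E ξ a`). Assume (i) for every degree `a`, `ξ ↦ H(ξ)(a)` is LOWER
semicontinuous on `S_cl`; (ii) at every `ξ ∈ S_cl` and every edge data `D` with the provenance `IsEdgeData`, `H(ξ)(a) = N(q(D); a)`
for all `a` (tree `EdgeHilbert.hilb`); (iii) only finitely many functions `H(ξ)`, `ξ ∈ S_cl`, occur. Then for EVERY edge-data selection
`sel` with that provenance, `ξ ↦ Inv_ξ(E)` read off `sel` (typed `selInv`, row 007's `inv`) is upper semicontinuous on `S_cl` (typed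
`UscOn`). Proof: fix `ξ₀`; each of the finitely many occurring functions that does NOT dominate `H(ξ₀)` fails in some degree `a`, and
lower semicontinuity in that degree excludes it near `ξ₀`; so near `ξ₀` (within `S_cl`) `H(ξ) ≥ H(ξ₀)` in every degree, i.e.
`N(q(D_ξ); ·) ≥ N(q(D_{ξ₀}); ·)`, whence `Inv_ξ ≤lex Inv_{ξ₀}` (`key_inv_le_of_hilb_le`). Replaces nothing printed (the manuscript
offers no argument, GAP R13); NOT a statement of the manuscript. [folklore] -/
theorem uscOn_selInv_of_edgeHilb
    {IsEdgeData : ∀ ⦃X : Scheme.{u}⦄ ⦃p n : ℕ⦄ (E : IdealExponent X) (ξ : X), EdgeDatumAt p n E ξ → Prop}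
    (hlsc : ∀ a : ℕ, LowerSemicontinuousOn (fun ξ => edgeHilbAt E ξ a) (E.sing ∩ S02Preliminaries.closedPoints Z))
    (hdict : ∀ ξ ∈ E.sing ∩ S02Preliminaries.closedPoints Z, ∀ D : EdgeDatumAt p n E ξ,
      IsEdgeData E ξ D → ∀ a : ℕ, edgeHilbAt E ξ a = (hilb (EdgeDatum.q D) a : ℕ∞))
    (hfin : (Set.range fun ξ : ↥(E.sing ∩ S02Preliminaries.closedPoints Z) =>
      fun a : ℕ => edgeHilbAt E (ξ : Z) a).Finite)
    (sel : EdgeDataSelection p n E IsEdgeData) : UscOn E.sing (selInv sel) := by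
  set T : Set Z := E.sing ∩ S02Preliminaries.closedPoints Z with hT
  set H : Z → ℕ → ℕ∞ := fun ξ a => edgeHilbAt E ξ a with hH
  show UpperSemicontinuousOn (fun ξ => (selInv sel ξ).key) T
  intro ξ₀ hξ₀ y hy
  -- Step 1: near `ξ₀` within `T`, the Hilbert function dominates `H ξ₀` in every degree.
  have hdom : ∀ᶠ ξ in 𝓝[T] ξ₀, ∀ a, H ξ₀ a ≤ H ξ a := by
    set F : Set (ℕ → ℕ∞) := Set.range fun ξ : ↥T => fun a : ℕ => edgeHilbAt E (ξ : Z) a with hF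
    have hFfin : F.Finite := hfin
    have hclaim : ∀ g ∈ F, ∀ᶠ ξ in 𝓝[T] ξ₀, (H ξ = g → ∀ a, H ξ₀ a ≤ H ξ a) := by
      intro g _
      by_cases hg : ∀ a, H ξ₀ a ≤ g a
      · exact Eventually.of_forall fun ξ hξg a => hξg ▸ hg a
      · push Not at hg
        obtain ⟨a, ha⟩ := hg
        have hev : ∀ᶠ ξ in 𝓝[T] ξ₀, g a < H ξ a := hlsc a ξ₀ hξ₀ (g a) ha
        exact hev.mono fun ξ hξ hξg => absurd (hξg ▸ hξ) (lt_irrefl _)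
    have hall : ∀ᶠ ξ in 𝓝[T] ξ₀, ∀ g ∈ F, (H ξ = g → ∀ a, H ξ₀ a ≤ H ξ a) :=
      (hFfin.eventually_all).mpr hclaim
    filter_upwards [hall, eventually_mem_nhdsWithin] with ξ hξ hξT
    exact hξ (H ξ) ⟨⟨ξ, hξT⟩, rfl⟩ rfl
  -- Step 2: domination of Hilbert functions gives `Inv_ξ ≤lex Inv_{ξ₀}`.
  filter_upwards [hdom, eventually_mem_nhdsWithin] with ξ hξ hξT
  have hξ₀' : ξ₀ ∈ E.sing ∩ S02Preliminaries.closedPoints Z := hξ₀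
  have hξT' : ξ ∈ E.sing ∩ S02Preliminaries.closedPoints Z := hξT
  have h0 : selInv sel ξ₀ = inv (sel.D ξ₀ hξ₀') := by
    simp only [selInv, dif_pos hξ₀']
  have h1 : selInv sel ξ = inv (sel.D ξ hξT') := by
    simp only [selInv, dif_pos hξT']
  have hle : (inv (sel.D ξ hξT')).key ≤ (inv (sel.D ξ₀ hξ₀')).key := by
    refine key_inv_le_of_hilb_le (sel.D ξ₀ hξ₀') (sel.D ξ hξT') fun a => ?_
    have e0 := hdict ξ₀ hξ₀' (sel.D ξ₀ hξ₀') (sel.isEdgeData ξ₀ hξ₀') a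
    have e1 := hdict ξ hξT' (sel.D ξ hξT') (sel.isEdgeData ξ hξT') a
    have hξa : H ξ₀ a ≤ H ξ a := hξ a
    rw [show H ξ₀ a = edgeHilbAt E ξ₀ a from rfl, show H ξ a = edgeHilbAt E ξ a from rfl, e0, e1] at hξa
    exact_mod_cast hξa
  have hy' : (inv (sel.D ξ₀ hξ₀')).key < y := by
    rw [← h0]
    exact hy
  show (selInv sel ξ).key < y
  rw [h1]
  exact lt_of_le_of_lt hle hy'

/-- **[OURS · L1 W3.1] well-definedness of `Inv_ξ(E)` from the dictionary**: if at `ξ` every provenance edge data `D` has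
`dim G(ξ)_a = N(q(D); a)` for all `a`, then any two provenance edge data at `ξ` give the same `Inv_ξ(E)` (typed
`CampaignW31.InvWellDefinedAt`). NOT a statement of the manuscript. [folklore] -/
theorem invWellDefinedAt_of_dictionary
    {IsEdgeData : ∀ ⦃X : Scheme.{u}⦄ ⦃p n : ℕ⦄ (E : IdealExponent X) (ξ : X), EdgeDatumAt p n E ξ → Prop} {ξ : Z}
    (hdict : ∀ D : EdgeDatumAt p n E ξ, IsEdgeData E ξ D → ∀ a : ℕ, edgeHilbAt E ξ a = (hilb (EdgeDatum.q D) a : ℕ∞)) :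
    InvWellDefinedAt p n E IsEdgeData ξ := by
  intro D D' hD hD'
  refine inv_eq_of_hilb_eq D' D fun a => ?_
  have e := hdict D hD a
  rw [hdict D' hD' a] at e
  exact_mod_cast e

end CampaignW31

open CampaignW31

/-! ## Corollaries on the typed campaign statements (parametric and `p`-sliced) -/

/-- **[OURS · L1 W3.1]** the slot statement and its CJS (superlevel-set) form are EQUIVALENT, for every provenance predicate.
NOT a statement of the manuscript. [folklore] -/
theorem campaignW31UscInvOneExponent_iff_CJS
    (IsEdgeData : ∀ ⦃X : Scheme.{u}⦄ ⦃p n : ℕ⦄ (E : IdealExponent X) (ξ : X), EdgeDatumAt p n E ξ → Prop) :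
    CampaignW31UscInvOneExponent.{u} IsEdgeData ↔ CampaignW31UscInvOneExponentCJS.{u} IsEdgeData :=
  ⟨fun h p _ K _ _ _ A n E hE sel => (uscOn_iff_superlevelClosedOn _ _).mp (h p K A n E hE sel),
    fun h p _ K _ _ _ A n E hE sel => (uscOn_iff_superlevelClosedOn _ _).mpr (h p K A n E hE sel)⟩

/-- **[OURS · L1 W3.1]** `p`-slices: `CampaignW31UscInvOneExponentI p ↔ CampaignW31UscInvOneExponentCJSI p`. NOT a statement of
the manuscript. [folklore] -/
theorem campaignW31UscInvOneExponentI_iff_CJSI (p : ℕ) [Fact p.Prime] :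
    CampaignW31UscInvOneExponentI.{u} p ↔ CampaignW31UscInvOneExponentCJSI.{u} p :=
  ⟨fun h K _ _ _ A n E hE sel => (uscOn_iff_superlevelClosedOn _ _).mp (h K A n E hE sel),
    fun h K _ _ _ A n E hE sel => (uscOn_iff_superlevelClosedOn _ _).mpr (h K A n E hE sel)⟩

/-- **[OURS · L1 W3.1] the slot statement implies its READING-idiom form** (`CampaignW31UscInvOneExponentR`, rows 010/019/020
shape `UscOn E.sing (inv E)`): given provenance edge data at every closed singular point (`EdgeDataExist`), CHOOSE a selection; an
`Inv`-reading consistent with Eq. (34) (`IsInvReading`) agrees with the selection's `selInv` on `Sing(E)_cl`, and `UscOn` only looks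
there (`uscOn_congr`). No well-definedness hypothesis is needed in this direction. NOT a statement of the manuscript. [folklore] -/
theorem campaignW31UscInvOneExponentR_of_uscInvOneExponent
    (IsEdgeData : ∀ ⦃X : Scheme.{u}⦄ ⦃p n : ℕ⦄ (E : IdealExponent X) (ξ : X), EdgeDatumAt p n E ξ → Prop)
    (h : CampaignW31UscInvOneExponent.{u} IsEdgeData) : CampaignW31UscInvOneExponentR.{u} IsEdgeData := by
  intro p _ n invR hinv K _ _ _ A E hE hex
  let sel : EdgeDataSelection p n E IsEdgeData :=
    ⟨fun ξ hξ => Classical.choose (hex ξ hξ), fun ξ hξ => Classical.choose_spec (hex ξ hξ)⟩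
  refine uscOn_congr E.sing (f := selInv sel) (fun ξ hξ => ?_) (h p K A n E hE sel)
  have hsel : selInv sel ξ = inv (sel.D ξ hξ) := by
    simp only [selInv, dif_pos hξ]
  rw [hsel]
  exact (hinv E ξ (sel.D ξ hξ) (sel.isEdgeData ξ hξ)).symm

/-- **[OURS · L1 W3.1] THE SLOT STATEMENT IMPLIES THE TWO p.30 CONSEQUENCES** (DOSSIER group-3 §2 R13b), parametric form:
`CampaignW31UscInvOneExponent IsEdgeData → CampaignW31InvmaxClosed IsEdgeData` (Noetherian ambient space; maximum attained on the
compact `Sing(E)_cl`; stratum = closed superlevel set of the maximum). NOT a statement of the manuscript. [folklore] -/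
theorem campaignW31InvmaxClosed_of_uscInvOneExponent
    (IsEdgeData : ∀ ⦃X : Scheme.{u}⦄ ⦃p n : ℕ⦄ (E : IdealExponent X) (ξ : X), EdgeDatumAt p n E ξ → Prop)
    (h : CampaignW31UscInvOneExponent.{u} IsEdgeData) : CampaignW31InvmaxClosed.{u} IsEdgeData :=
  fun p _ K _ _ _ A n E hE sel => invmaxAttained_and_stratumClosed_of_uscOn A sel (h p K A n E hE sel)

/-- **[OURS · L1 W3.1]** `p`-slices: `CampaignW31UscInvOneExponentI p → CampaignW31InvmaxClosedI p`. NOT a statement of the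
manuscript. [folklore] -/
theorem campaignW31InvmaxClosedI_of_uscInvOneExponentI (p : ℕ) [Fact p.Prime]
    (h : CampaignW31UscInvOneExponentI.{u} p) : CampaignW31InvmaxClosedI.{u} p :=
  fun K _ _ _ A n E hE sel => invmaxAttained_and_stratumClosed_of_uscOn A sel (h K A n E hE sel)

/-- **[OURS · L1 W3.1] THE SLOT STATEMENT FROM THE THREE EDGE-ALGEBRA INPUTS** (typed for seat res-L1-s31-pv-2 in
`…EdgeHilbertLsc.lean`): `CampaignW31EdgeHilbLsc p → CampaignW31EdgeHilbDictionary p → CampaignW31EdgeHilbFiniteRange p →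
CampaignW31UscInvOneExponentI p`. NOT a statement of the manuscript. [folklore] -/
theorem campaignW31UscInvOneExponentI_of_edgeHilb (p : ℕ) [Fact p.Prime]
    (hlsc : CampaignW31EdgeHilbLsc.{u} p) (hdict : CampaignW31EdgeHilbDictionary.{u} p)
    (hfin : CampaignW31EdgeHilbFiniteRange.{u} p) : CampaignW31UscInvOneExponentI.{u} p :=
  fun K _ _ _ A n E hE sel =>
    uscOn_selInv_of_edgeHilb (hlsc K A E hE) (hdict K A n E hE) (hfin K A E hE) sel

/-- **[OURS · L1 W3.1] `Inv` IS WELL DEFINED FROM THE DICTIONARY**: `CampaignW31EdgeHilbDictionary p → CampaignW31InvWellDefinedI p`.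
NOT a statement of the manuscript. [folklore] -/
theorem campaignW31InvWellDefinedI_of_dictionary (p : ℕ) [Fact p.Prime] (hdict : CampaignW31EdgeHilbDictionary.{u} p) :
    CampaignW31InvWellDefinedI.{u} p :=
  fun K _ _ _ A n E hE ξ hξ => invWellDefinedAt_of_dictionary (hdict K A n E hE ξ hξ)

/-- **[OURS · L1 W3.1] the chain to the p.30 consequences**: the three edge-algebra inputs imply `Inv_max` attained and the
`Inv_max`-stratum closed (`CampaignW31InvmaxClosedI p`). NOT a statement of the manuscript. [folklore] -/
theorem campaignW31InvmaxClosedI_of_edgeHilb (p : ℕ) [Fact p.Prime]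
    (hlsc : CampaignW31EdgeHilbLsc.{u} p) (hdict : CampaignW31EdgeHilbDictionary.{u} p)
    (hfin : CampaignW31EdgeHilbFiniteRange.{u} p) : CampaignW31InvmaxClosedI.{u} p :=
  campaignW31InvmaxClosedI_of_uscInvOneExponentI p (campaignW31UscInvOneExponentI_of_edgeHilb p hlsc hdict hfin)

end Summit.ResolutionOfSingularities.ResolutionOfSingularities.Theorems
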